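/-
Origin: expansion seat `planner-pub-hodgecm-mc-theta-3-g12-0`, handover (U1) 2026-08-20T04:02Z md5 eb41ccdf8a34910083542e2f8073d464 (83 l.; NEW additive leaf over installed (F1) `HodgeCM.Model.ArchLineDatumOf`; uniqueness of (F1)'s centre character `lineCenterChar` from its vacuum equation; 3 theorems; rc 0 / 0 warn / trio 3/3) (`HOME/mc/pub-hodgecm-mc-theta-3-g12/lean/stage40/HodgeCM/Model/ArchLineCenterChar.lean`, md5 eb41ccdf8a34, 83 lines);
landed by the second packager p2 gen 2 (p2-g2) in gate run 40 as `HodgeCM/Model/ArchLineCenterChar.lean` (verbatim).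
-/
/-
Origin: speedrun cell pub-hodgecm, MODEL-CONSTRUCTION sub-cell, lineage mc-theta-3 (BINDER-OWNERS row 5, the `𝔄` slot),
seat planner-pub-hodgecm-mc-theta-3-g11-0 (gen 11), 2026-08-20.  Target in PKG: `HodgeCM/Model/ArchLineCenterChar.lean`
(NEW additive leaf over `HodgeCM.Model.ArchLineDatumOf` (F1)).  KERNEL only: 0 records / named facts / proof holes.
-/
import Summits.HodgeConjecture.HodgeCM.Model.ArchLineDatumOf_3

/-!
# The centre character of the line datum is DETERMINED by the vacuum equation

(F1) defines `lineCenterChar V d hd hd0 hGRd : (∞-torus of the centre) →* Circle` as the choice produced by binder-2's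
compact-letters engine and records its vacuum equation `lineCenterChar_vacuum :
ω_∞(t·1_V, 1) (follandFock 𝔢 1) = lineCenterChar t • follandFock 𝔢 1`.  This leaf records that the equation PINS the
character: any `χ'` with the same vacuum equation equals `lineCenterChar` (`lineCenterChar_unique`), because the vacuum
vector `follandFock 𝔢 1` is nonzero (`follandFock_one_ne_zero`).  So `lineCenterChar` is checkable data (the same standing as
binder-2's `pinTorusChar`), and any closed form proved for the vacuum eigenvalue IS `lineCenterChar`
(`lineCenterChar_eq_of_vacuum`).  [Folland1989, Prop. (4.39); Weil1964, Chap. I n° 12 — the vacuum is a `K`-eigenvector.]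
-/

set_option autoImplicit false

noncomputable section

open NumberField NumberField.InfinitePlace NumberField.mixedEmbedding IsDedekindDomain
open scoped Matrix Kronecker Classical TensorProduct ComplexConjugate SchwartzMap
open MvPolynomial
open Literature.NumberTheory.Automorphic Literature.NumberTheory.Automorphic.UnitaryGroup Literature.NumberTheory.Weil1964
open Literature.RepresentationTheory.KonnoKonno2007 Literature.RepresentationTheory.KonnoKonno2007.RealDualPair
open Literature.NumberTheory.GelbartRogawski1991 Literature.NumberTheory.GelbartRogawski1991.UnitaryDualPair
open Literature.Analysis.SegalBargmann
open HodgeCM.Adelic HodgeCM.PerL34 HodgeCM.Model.HypCensus HodgeCM.Model.SupplyInstance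

namespace HodgeCM.Model.ArchSideTerm

/-- the Folland–Fock vector of the constant polynomial `1` (the vacuum of the frame `e`) is nonzero. [folklore] -/
theorem follandFock_one_ne_zero {D : Type} [NormedAddCommGroup D] [NormedSpace ℝ D] {σ : Type} [Fintype σ]
    (e : D ≃L[ℝ] (σ → ℝ)) : follandFock e (1 : MvPolynomial σ ℂ) ≠ 0 := fun h => by
  have h1 := schwartzTransport_follandFock e (1 : MvPolynomial σ ℂ)
  rw [h, map_zero] at h1
  exact binvPi_one_ne_zero h1.symm

variable {L : CMField} {ι₁ : L →+* ℂ} (V : HermSpace3 L ι₁)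
variable (d : (L : Type)) (hd : IsCMField.complexConj L d = d) (hd0 : d ≠ 0)
  (hGRd : (cmSplittingDatum (L : Type) (e₁) (frameD V) (frameD_real V) (frameD_ne V) (lineVec (L : Type) d) (fun _ => hd)
    (fun _ => hd0)).CompatibleSplitting)

/-- **the vacuum equation pins the centre character**: a character with `lineCenterChar`'s vacuum equation IS `lineCenterChar`. -/
theorem lineCenterChar_eq_of_vacuum
    (χ' : ↥(Literature.NumberTheory.Automorphic.relNormOneInfUnits (↥(maximalRealSubfield L)) L) →* Circle)
    (hχ' : ∀ t, cmArchWeilRep (L : Type) e₁ (frameD V) (frameD_real V) (frameD_ne V) (lineVec (L : Type) d) (fun _ => hd)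
        (fun _ => hd0) hGRd (cmArchCenter (L : Type) 3 (Matrix.diagonal (frameD V)) t, 1)
        (follandFock (cmBigFrame (L : Type) e₁ (frameD V) (frameD_real V) (frameD_ne V) (lineVec (L : Type) d) (fun _ => hd)
          (fun _ => hd0) ι₁) 1) =
      ((χ' t : Circle) : ℂ) • follandFock (cmBigFrame (L : Type) e₁ (frameD V) (frameD_real V) (frameD_ne V) (lineVec (L : Type) d)
          (fun _ => hd) (fun _ => hd0) ι₁) 1) :
    χ' = lineCenterChar V d hd hd0 hGRd := by
  ext t
  have h := (hχ' t).symm.trans (lineCenterChar_vacuum V d hd hd0 hGRd t)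
  have hΩ := follandFock_one_ne_zero (cmBigFrame (L : Type) e₁ (frameD V) (frameD_real V) (frameD_ne V) (lineVec (L : Type) d)
    (fun _ => hd) (fun _ => hd0) ι₁)
  exact congrArg (fun z : ℂ => z) (smul_left_injective ℂ hΩ h)

/-- uniqueness, symmetric form. -/
theorem lineCenterChar_unique
    (χ₁ χ₂ : ↥(Literature.NumberTheory.Automorphic.relNormOneInfUnits (↥(maximalRealSubfield L)) L) →* Circle)
    (h₁ : ∀ t, cmArchWeilRep (L : Type) e₁ (frameD V) (frameD_real V) (frameD_ne V) (lineVec (L : Type) d) (fun _ => hd)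
        (fun _ => hd0) hGRd (cmArchCenter (L : Type) 3 (Matrix.diagonal (frameD V)) t, 1)
        (follandFock (cmBigFrame (L : Type) e₁ (frameD V) (frameD_real V) (frameD_ne V) (lineVec (L : Type) d) (fun _ => hd)
          (fun _ => hd0) ι₁) 1) =
      ((χ₁ t : Circle) : ℂ) • follandFock (cmBigFrame (L : Type) e₁ (frameD V) (frameD_real V) (frameD_ne V) (lineVec (L : Type) d)
          (fun _ => hd) (fun _ => hd0) ι₁) 1)
    (h₂ : ∀ t, cmArchWeilRep (L : Type) e₁ (frameD V) (frameD_real V) (frameD_ne V) (lineVec (L : Type) d) (fun _ => hd)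
        (fun _ => hd0) hGRd (cmArchCenter (L : Type) 3 (Matrix.diagonal (frameD V)) t, 1)
        (follandFock (cmBigFrame (L : Type) e₁ (frameD V) (frameD_real V) (frameD_ne V) (lineVec (L : Type) d) (fun _ => hd)
          (fun _ => hd0) ι₁) 1) =
      ((χ₂ t : Circle) : ℂ) • follandFock (cmBigFrame (L : Type) e₁ (frameD V) (frameD_real V) (frameD_ne V) (lineVec (L : Type) d)
          (fun _ => hd) (fun _ => hd0) ι₁) 1) :
    χ₁ = χ₂ :=
  (lineCenterChar_eq_of_vacuum V d hd hd0 hGRd χ₁ h₁).trans (lineCenterChar_eq_of_vacuum V d hd hd0 hGRd χ₂ h₂).symm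

end HodgeCM.Model.ArchSideTerm

end
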